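import Summits.CriticalPhenomena.PercolationContinuityZ3.Theorems.PercAnnulusCrossingNoiseJuntas
import Summits.CriticalPhenomena.PercolationContinuityZ3.Theorems.PercAnnulusCrossingNoiseSeeds
import HarnessLib

/-!
# RSW3 lane (lead, gen 21): THE SPECTRAL SAMPLE OF A CROSSING, III — DECORRELATION FROM EVERY LOW-DEGREE STATISTIC:
# `|E[f·G] − E f·E G| ≤ k·√(δ·E[f²])·σ(G)` for every sum `G` of `k`-local functions (Benjamini–Kalai–Schramm's majority theorem, `k = 1`)

builds on p205010 (kernel theorem, internal audit signed; external expert review pending) — NOT used in this file (abstract; every finite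
product cube / every finite edge-labelled graph).

Cell `prim-rsw3` (LANE 3), lead seat, gen 21.  Support file (`--supports stmt-CriticalPhenomena-4575`); no definitions, no named facts,
no sorries.  Setting of gen 20's parts III (`…NoiseRevealment`: `Σ_{1≤|S|≤k} f̂(S)² ≤ k²δE[f²]` under mixed revealment `δ`) and VIII (`…NoiseJuntas`:
an `M`-junta has no coefficients off `M`).  A STATISTIC OF DEGREE `≤ k` is here any finite sum `G = Σ_t g_t` of `k`-LOCAL functions (`g_t` reads only
the coordinates of a set `M_t` with `|M_t| ≤ k`): for `k = 1` every affine function of the bits — every weighted count `Σ_i a_i 𝟙[x_i]`, the linear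
proxies of BKS's weighted majorities; for `k = 2` every pair statistic (e.g. the number of adjacent open pairs); in general the empirical count of any
pattern on `≤ k` coordinates.  Proved, every `p ∈ [0,1]^ι`:

* §1 `coeff_sum_local_eq_zero` — `Ĝ(S) = 0` for `|S| > k`; `sum_powerset_filter_card_le_sum_Icc` (regrouping);
  **`abs_cov_le_sqrt_low_weight_mul_sqrt_var`** — for any character system, `|E[fG] − E f E G| ≤ √(Σ_{1≤|S|≤k} f̂(S)²)·√(E G² − (E G)²)`
  (Plancherel + Cauchy–Schwarz on the levels `1..k`);
  **`abs_cov_le_of_local_sum_of_revealment`** — WITH SCHRAMM–STEIF: if `f` is computed by reduced trees mixed with weights `q_t` revealing every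
  coordinate with probability `≤ δ`, then **`|E_p[f·G] − E_p[f]·E_p[G]| ≤ k·√(δ·E_p[f²])·√(Var_p G)`** — no characters in the statement.
  (Gen 20's junta bound `|M|√(δ E f² E G²)` is the case of ONE local function, with `E G²` improved to `Var G`.)
* §2 CROSSINGS (finite edge-labelled graph, separating seed family of mixed revealment `≤ δ`): **`abs_cov_gcross_le_of_local_sum`** —
  `|E[𝟙{X↔B}·G] − P(X↔B)·E[G]| ≤ k·√(δ·P(X↔B))·σ(G)`; **`abs_cov_gcross_linear_le`** (`k = 1`, direct from gen 20's squared-influence bound,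
  no Fourier analysis): for every weight vector `a`, **`|E[𝟙{X↔B}·Σ_e a_e𝟙[ω_e]] − P·Σ_e a_e p_e| ≤ √(δ·P)·√(Σ_e a_e² p_e(1−p_e))`** — a crossing
  explored with small revealment is nearly uncorrelated with EVERY WEIGHTED EDGE COUNT (BKS: crossings are asymptotically uncorrelated with the
  [linear statistics behind the] weighted majority functions; Thm 1.7 there characterises noise sensitivity of monotone events this way).

References: I. Benjamini, G. Kalai, O. Schramm, Publ. IHÉS 90 (1999) §1.3 Thms 1.6–1.7 (majority and weighted majority), Thm 1.9 (low
Fourier levels), §1.4; O. Schramm, J. Steif, Ann. of Math. 171 (2010) Thm 1.8; R. O'Donnell, *Analysis of Boolean Functions* (CUP 2014) §8.3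
(Plancherel, degree), §3.1; C. Garban, J. Steif, CUP 2014, Ch. IV §3, Ch. VIII Thm VIII.1.
-/

noncomputable section

namespace Summit.CriticalPhenomena.PercolationContinuityZ3.Theorems.Crossing.Spectral

open Finset Function
open Literature.Probability.ODonnellSaksSchrammServedio2005

variable {ι : Type*} [Fintype ι] [DecidableEq ι]

/-! ## §1 Sums of `k`-local functions have degree `≤ k`; covariance against the low levels -/

/-- **A SUM OF `k`-LOCAL FUNCTIONS HAS NO COEFFICIENTS ABOVE LEVEL `k`**: if each `g_t` reads only `M_t`, `|M_t| ≤ k`, and `|S| > k`, then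
`(Σ_t g_t)^(S) = 0` (each `S ⊄ M_t`, gen 20's `coeff_eq_zero_of_junta`). [cite: ODonnell2014, §8.3 (degree of f = max |S| with f̂(S) ≠ 0; juntas)] -/
theorem coeff_sum_local_eq_zero {p : ι → ℝ} {r : ι → Bool → ℝ} (hH1 : ∀ i, p i * r i true + (1 - p i) * r i false = 0)
    {τ : Type*} [Fintype τ] {k : ℕ} (M : τ → Finset ι) (hM : ∀ t, (M t).card ≤ k) (g : τ → (ι → Bool) → ℝ)
    (hg : ∀ t x i c, i ∉ M t → g t (update x i c) = g t x) {S : Finset ι} (hS : k < S.card) :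
    ∑ x : ι → Bool, wt p x * ((∑ t, g t x) * ∏ j ∈ S, r j (x j)) = 0 := by
  have hlin : ∑ x : ι → Bool, wt p x * ((∑ t, g t x) * ∏ j ∈ S, r j (x j))
      = ∑ t, ∑ x : ι → Bool, wt p x * (g t x * ∏ j ∈ S, r j (x j)) := by
    rw [Finset.sum_comm]
    refine Finset.sum_congr rfl fun x _ => ?_
    rw [Finset.sum_mul, Finset.mul_sum]
  rw [hlin]
  refine Finset.sum_eq_zero fun t _ => coeff_eq_zero_of_junta hH1 (hg t) ?_
  intro hSM
  exact absurd (lt_of_lt_of_le hS (Finset.card_le_card hSM)) (not_lt.2 (hM t))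

/-- Regrouping: the nonempty sets of cardinality `≤ k` sit inside the levels `1..k`, so for nonnegative summands
`Σ_{S ≠ ∅, |S| ≤ k} c_S ≤ Σ_{j=1}^{k} Σ_{|S|=j} c_S`. [folklore] -/
theorem sum_powerset_filter_card_le_sum_Icc (k : ℕ) (c : Finset ι → ℝ) (hc : ∀ S, 0 ≤ c S) :
    ∑ S ∈ ((Finset.univ : Finset ι).powerset.erase ∅).filter (fun S => S.card ≤ k), c S
      ≤ ∑ j ∈ Finset.Icc 1 k, ∑ S ∈ (Finset.univ : Finset ι).powersetCard j, c S := by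
  rw [← Finset.sum_biUnion]
  · refine Finset.sum_le_sum_of_subset_of_nonneg ?_ (fun S _ _ => hc S)
    intro S hS
    simp only [Finset.mem_filter, Finset.mem_erase] at hS
    obtain ⟨⟨hS0, _⟩, hSk⟩ := hS
    rw [Finset.mem_biUnion]
    refine ⟨S.card, Finset.mem_Icc.2 ⟨Finset.card_pos.2 (Finset.nonempty_iff_ne_empty.2 hS0), hSk⟩, ?_⟩
    exact Finset.mem_powersetCard.2 ⟨Finset.subset_univ S, rfl⟩
  · intro j _ l _ hjl
    exact Finset.disjoint_left.2 fun S hSj hSl =>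
      hjl ((Finset.mem_powersetCard.1 hSj).2.symm.trans (Finset.mem_powersetCard.1 hSl).2)

section Characters

variable {p : ι → ℝ} (h0 : ∀ i, 0 ≤ p i) (h1 : ∀ i, p i ≤ 1) {r : ι → Bool → ℝ}
  (hH1 : ∀ i, p i * r i true + (1 - p i) * r i false = 0)
  (hH2 : ∀ i (b b' : Bool), coordWt p i b ≠ 0 → coordWt p i b' * (1 + r i b * r i b') = if b' = b then 1 else 0)

include hH1 hH2 in
/-- **COVARIANCE AGAINST A LOW-DEGREE STATISTIC IS CARRIED BY THE LOW LEVELS**: for any character system and any sum `G = Σ_t g_t` of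
`k`-local functions, `|E[f·G] − E[f]·E[G]| ≤ √(Σ_{1≤j≤k} Σ_{|S|=j} f̂(S)²)·√(E[G²] − E[G]²)` (Plancherel: the covariance is `Σ_{S≠∅} f̂(S)Ĝ(S)`,
and `Ĝ` vanishes above level `k`; Cauchy–Schwarz). [cite: BenjaminiKalaiSchramm1999, Thm 1.9 (noise sensitivity ⇔ vanishing low levels)]
[cite: ODonnell2014, §8.3 (Plancherel) and §3.1] -/
theorem abs_cov_le_sqrt_low_weight_mul_sqrt_var (f : (ι → Bool) → ℝ) {τ : Type*} [Fintype τ] {k : ℕ} (M : τ → Finset ι)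
    (hM : ∀ t, (M t).card ≤ k) (g : τ → (ι → Bool) → ℝ) (hg : ∀ t x i c, i ∉ M t → g t (update x i c) = g t x) :
    |(∑ x : ι → Bool, wt p x * (f x * ∑ t, g t x))
        - (∑ x : ι → Bool, wt p x * f x) * (∑ x : ι → Bool, wt p x * ∑ t, g t x)|
      ≤ Real.sqrt (∑ j ∈ Finset.Icc 1 k, ∑ S ∈ (Finset.univ : Finset ι).powersetCard j,
            (∑ x : ι → Bool, wt p x * (f x * ∏ i ∈ S, r i (x i))) ^ 2)
        * Real.sqrt ((∑ x : ι → Bool, wt p x * ((∑ t, g t x) * ∑ t, g t x)) - (∑ x : ι → Bool, wt p x * ∑ t, g t x) ^ 2) := by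
  classical
  obtain ⟨a, ha⟩ : ∃ a : Finset ι → ℝ, a = fun S => ∑ x : ι → Bool, wt p x * (f x * ∏ i ∈ S, r i (x i)) := ⟨_, rfl⟩
  obtain ⟨b, hb⟩ : ∃ b : Finset ι → ℝ, b = fun S => ∑ x : ι → Bool, wt p x * ((∑ t, g t x) * ∏ i ∈ S, r i (x i)) := ⟨_, rfl⟩
  set P : Finset (Finset ι) := (Finset.univ : Finset ι).powerset with hP
  set A : Finset (Finset ι) := (P.erase ∅).filter (fun S => S.card ≤ k) with hA
  have h0P : (∅ : Finset ι) ∈ P := Finset.empty_mem_powerset _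
  -- Plancherel and the empty coefficients
  have hfg : ∑ x : ι → Bool, wt p x * (f x * ∑ t, g t x) = ∑ S ∈ P, a S * b S := by
    rw [sum_wt_mul_mul_eq_sum_coeff hH2 f (fun x => ∑ t, g t x), ha, hb]
  have hf0 : ∑ x : ι → Bool, wt p x * f x = a ∅ := by rw [ha]; simp
  have hg0 : ∑ x : ι → Bool, wt p x * ∑ t, g t x = b ∅ := by rw [hb]; simp
  -- the covariance is the sum over `∅ ≠ S`, `|S| ≤ k`
  have hbz : ∀ S ∈ P.erase ∅, ¬ S.card ≤ k → a S * b S = 0 := by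
    intro S _ hSk
    have hbS : b S = 0 := by
      simp only [hb]
      exact coeff_sum_local_eq_zero (r := r) hH1 M hM g hg (not_le.1 hSk)
    rw [hbS, mul_zero]
  have hcov : (∑ x : ι → Bool, wt p x * (f x * ∑ t, g t x))
        - (∑ x : ι → Bool, wt p x * f x) * (∑ x : ι → Bool, wt p x * ∑ t, g t x)
      = ∑ S ∈ A, a S * b S := by
    rw [hfg, hf0, hg0, ← Finset.add_sum_erase P _ h0P, add_sub_cancel_left, hA, Finset.sum_filter]
    refine Finset.sum_congr rfl fun S hS => ?_
    split_ifs with hSk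
    · rfl
    · exact hbz S hS hSk
  rw [hcov]
  -- Cauchy–Schwarz over `A`
  have hCS := Finset.sum_mul_sq_le_sq_mul_sq A a b
  have hAa : ∑ S ∈ A, a S ^ 2 ≤ ∑ j ∈ Finset.Icc 1 k, ∑ S ∈ (Finset.univ : Finset ι).powersetCard j, a S ^ 2 :=
    sum_powerset_filter_card_le_sum_Icc k (fun S => a S ^ 2) (fun S => sq_nonneg _)
  have hvar : (∑ x : ι → Bool, wt p x * ((∑ t, g t x) * ∑ t, g t x)) - (∑ x : ι → Bool, wt p x * ∑ t, g t x) ^ 2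
      = ∑ S ∈ P.erase ∅, b S ^ 2 := by
    have hpars : ∑ x : ι → Bool, wt p x * ((∑ t, g t x) * ∑ t, g t x) = ∑ S ∈ P, b S ^ 2 := by
      rw [sum_wt_mul_sq_eq_sum_coeff_sq hH2 (fun x => ∑ t, g t x)]
      simp only [hb, hP]
    rw [hpars, hg0, ← Finset.add_sum_erase P _ h0P]
    ring
  have hAb : ∑ S ∈ A, b S ^ 2 ≤ ∑ S ∈ P.erase ∅, b S ^ 2 :=
    Finset.sum_le_sum_of_subset_of_nonneg (Finset.filter_subset _ _) (fun S _ _ => sq_nonneg _)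
  have hL0 : 0 ≤ ∑ j ∈ Finset.Icc 1 k, ∑ S ∈ (Finset.univ : Finset ι).powersetCard j, a S ^ 2 :=
    Finset.sum_nonneg fun j _ => Finset.sum_nonneg fun S _ => sq_nonneg _
  have hV0 : 0 ≤ ∑ S ∈ P.erase ∅, b S ^ 2 := Finset.sum_nonneg fun S _ => sq_nonneg _
  have hsq : (∑ S ∈ A, a S * b S) ^ 2
      ≤ (Real.sqrt (∑ j ∈ Finset.Icc 1 k, ∑ S ∈ (Finset.univ : Finset ι).powersetCard j, a S ^ 2)
          * Real.sqrt (∑ S ∈ P.erase ∅, b S ^ 2)) ^ 2 := by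
    rw [mul_pow, Real.sq_sqrt hL0, Real.sq_sqrt hV0]
    calc (∑ S ∈ A, a S * b S) ^ 2 ≤ (∑ S ∈ A, a S ^ 2) * ∑ S ∈ A, b S ^ 2 := hCS
      _ ≤ (∑ j ∈ Finset.Icc 1 k, ∑ S ∈ (Finset.univ : Finset ι).powersetCard j, a S ^ 2) * ∑ S ∈ P.erase ∅, b S ^ 2 :=
          mul_le_mul hAa hAb (Finset.sum_nonneg fun S _ => sq_nonneg _) hL0
  have hfin := abs_le_of_sq_le_sq hsq (mul_nonneg (Real.sqrt_nonneg _) (Real.sqrt_nonneg _))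
  rw [hvar]
  simpa only [ha] using hfin

end Characters

/-- **DECORRELATION FROM EVERY LOW-DEGREE STATISTIC** (Schramm–Steif + Plancherel; every `p ∈ [0,1]^ι`): let `f` be computed by the reduced
trees `T_t` mixed with weights `q_t`, every coordinate being revealed with mixed probability `≤ δ`, and let `G = Σ_s g_s` be a sum of `k`-local
functions (`g_s` reads only `M_s`, `|M_s| ≤ k`).  Then **`|E_p[f·G] − E_p[f]·E_p[G]| ≤ k·√(δ·E_p[f²])·√(E_p[G²] − E_p[G]²)`** — for `k = 1`:
`f` is nearly uncorrelated with every affine function of the bits (every weighted count); for an indicator `f = 𝟙_A` the correlation coefficient with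
`G` is at most `k√(δ/(1 − P(A)))`. [cite: SchrammSteif2010, Thm 1.8] [cite: BenjaminiKalaiSchramm1999, §1.3 Thm 1.7 and Thm 1.9]
[cite: GarbanSteif2014, Ch. VIII Thm VIII.1] -/
theorem abs_cov_le_of_local_sum_of_revealment (p : ι → ℝ) (h0 : ∀ i, 0 ≤ p i) (h1 : ∀ i, p i ≤ 1)
    (f : (ι → Bool) → ℝ) {τ : Type*} [Fintype τ] (q : τ → ℝ) (hq0 : ∀ t, 0 ≤ q t) (hq1 : ∑ t, q t = 1)
    (T : τ → DecTree ι) (hT : ∀ t, (T t).Reduced) (hf : ∀ t x, (T t).eval x = f x) {δ : ℝ} (hδ0 : 0 ≤ δ)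
    (hδ : ∀ i, ∑ t, q t * ∑ x : ι → Bool, wt p x * (if i ∈ (T t).queried x then (1 : ℝ) else 0) ≤ δ)
    {σ : Type*} [Fintype σ] {k : ℕ} (M : σ → Finset ι) (hM : ∀ s, (M s).card ≤ k) (g : σ → (ι → Bool) → ℝ)
    (hg : ∀ s x i c, i ∉ M s → g s (update x i c) = g s x) :
    |(∑ x : ι → Bool, wt p x * (f x * ∑ s, g s x))
        - (∑ x : ι → Bool, wt p x * f x) * (∑ x : ι → Bool, wt p x * ∑ s, g s x)|
      ≤ k * Real.sqrt (δ * ∑ x : ι → Bool, wt p x * (f x * f x))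
        * Real.sqrt ((∑ x : ι → Bool, wt p x * ((∑ s, g s x) * ∑ s, g s x)) - (∑ x : ι → Bool, wt p x * ∑ s, g s x) ^ 2) := by
  have hH1 := pbiased_H1 p
  have hH2 := pbiased_H2 p h0 h1
  have h := abs_cov_le_sqrt_low_weight_mul_sqrt_var (r := fun i b => ((if b then (1 : ℝ) else 0) - p i) / Real.sqrt (p i * (1 - p i)))
    hH1 hH2 f M hM g hg
  refine h.trans (mul_le_mul_of_nonneg_right ?_ (Real.sqrt_nonneg _))
  -- `√(W_{1..k}) ≤ √(k²δE f²) = k√(δ E f²)`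
  have hW := low_level_weight_le_revealment p h0 h1 (r := fun i b => ((if b then (1 : ℝ) else 0) - p i) / Real.sqrt (p i * (1 - p i)))
    hH1 hH2 f q hq0 hq1 T hT hf k hδ0 hδ
  have hF0 : 0 ≤ ∑ x : ι → Bool, wt p x * (f x * f x) := Finset.sum_nonneg fun x _ => mul_nonneg (wt_nonneg h0 h1 x) (mul_self_nonneg _)
  calc Real.sqrt (∑ j ∈ Finset.Icc 1 k, ∑ S ∈ (Finset.univ : Finset ι).powersetCard j,
          (∑ x : ι → Bool, wt p x * (f x * ∏ i ∈ S, (((if x i then (1 : ℝ) else 0) - p i) / Real.sqrt (p i * (1 - p i))))) ^ 2)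
      ≤ Real.sqrt ((k : ℝ) ^ 2 * δ * ∑ x : ι → Bool, wt p x * (f x * f x)) := Real.sqrt_le_sqrt hW
    _ = k * Real.sqrt (δ * ∑ x : ι → Bool, wt p x * (f x * f x)) := by
        rw [mul_assoc, Real.sqrt_mul (sq_nonneg _), Real.sqrt_sq (Nat.cast_nonneg _)]

/-! ## §2 Crossings explored from a random separating seed set -/

section Crossing

open Literature.Probability.Percolation
open Literature.Probability.ODonnellSaksSchrammServedio2005.Strategy
open Literature.Probability.Percolation.GhostExploration Literature.Probability.Percolation.SeedExploration

variable {W E : Type*} {edge : W → W → Option E} [Fintype E] [DecidableEq E]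
  (hsymm : ∀ a b, edge a b = edge b a) (hends : ∀ e a b a' b', edge a b = some e → edge a' b' = some e → a' = a ∨ a' = b)
  (p : E → ℝ) (h0 : ∀ e, 0 ≤ p e) (h1 : ∀ e, p e ≤ 1) {X B : Set W} {σ : Type*} [Fintype σ] (Z : σ → Set W)
  (hsep : ∀ s (y : E → Bool) (a b : W), a ∈ X → b ∈ B → YReach edge y a b → ∃ u ∈ Z s, YReach edge y u a ∧ YReach edge y u b)
  (q : σ → ℝ) (hq0 : ∀ s, 0 ≤ q s) (hq1 : ∑ s, q s = 1) {δ : ℝ} (hδ0 : 0 ≤ δ)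
  (hδ : ∀ e a b, edge a b = some e → ∑ s, q s * (seedProb edge p (Z s) a + seedProb edge p (Z s) b) ≤ δ)

include hsymm hends h0 h1 hsep hq0 hq1 hδ0 hδ in
open Classical in
/-- **A CROSSING IS NEARLY UNCORRELATED WITH EVERY LOW-DEGREE STATISTIC** (finite edge-labelled graph; separating seed family with mixed
revealment `≤ δ`): for every sum `G = Σ_t g_t` of `k`-local functions of the edge variables,
**`|E[𝟙{X↔B}·G] − P(X↔B)·E[G]| ≤ k·√(δ·P(X↔B))·√(E[G²] − E[G]²)`**. [cite: SchrammSteif2010, Thm 1.8] [cite: BenjaminiKalaiSchramm1999, §1.3 Thm 1.7, Thm 1.9] -/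
theorem abs_cov_gcross_le_of_local_sum {τ : Type*} [Fintype τ] {k : ℕ} (M : τ → Finset E) (hM : ∀ t, (M t).card ≤ k)
    (g : τ → (E → Bool) → ℝ) (hg : ∀ t x i c, i ∉ M t → g t (update x i c) = g t x) :
    |(∑ x : E → Bool, wt p x * (gcross edge X B x * ∑ t, g t x))
        - (∑ x : E → Bool, wt p x * gcross edge X B x) * (∑ x : E → Bool, wt p x * ∑ t, g t x)|
      ≤ k * Real.sqrt (δ * ∑ x : E → Bool, wt p x * gcross edge X B x)
        * Real.sqrt ((∑ x : E → Bool, wt p x * ((∑ t, g t x) * ∑ t, g t x)) - (∑ x : E → Bool, wt p x * ∑ t, g t x) ^ 2) := by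
  have hsq : ∀ x, gcross edge X B x * gcross edge X B x = gcross edge X B x := by
    intro x; rcases gcross_mem edge X B x with h | h <;> simp [h]
  have h := abs_cov_le_of_local_sum_of_revealment p h0 h1 (gcross edge X B) q hq0 hq1
    (fun s => tree (strategy edge (Z s)) (fun σ' => if ∃ u ∈ Z s, (∃ a ∈ X, SReach edge σ' u a) ∧ ∃ b ∈ B, SReach edge σ' u b then (1 : ℝ) else 0))
    (fun s => tree_seed_reduced (Z s) _) (fun s x => tree_seed_eval hsymm (hsep s) x) hδ0
    (sum_revealment_seed_le hends p h0 h1 Z q hq0 _ hδ0 hδ) M hM g hg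
  simp only [hsq] at h
  exact h

omit [DecidableEq E] in
/-- The variance of a weighted count: `E[(Σ_e a_e(𝟙[x_e] − p_e))²] = Σ_e a_e²·p_e(1−p_e)` (independent coordinates).
[cite: ODonnell2014, §8.4 (the p-biased product distribution; φ_i orthogonal with variance σ_i²)] -/
theorem sum_wt_mul_sq_sum_ctr [DecidableEq E] (a : E → ℝ) :
    ∑ x : E → Bool, wt p x * (∑ e, a e * ctr p e x) ^ 2 = ∑ e, a e ^ 2 * (p e * (1 - p e)) := by
  -- expand the square; the mixed terms vanish by independence and `E[ctr_e] = 0`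
  have hdiag : ∀ e e' : E, ∑ x : E → Bool, wt p x * (ctr p e x * ctr p e' x) = if e = e' then p e * (1 - p e) else 0 := by
    intro e e'
    rw [sum_wt_mul_ctr_eq p e' (fun x => ctr p e x)]
    split_ifs with hee
    · subst hee
      have : ∀ x : E → Bool, ctr p e (update x e true) - ctr p e (update x e false) = 1 := by
        intro x; simp [ctr]
      simp only [this, ← Finset.sum_mul, sum_wt]; ring
    · have : ∀ x : E → Bool, ctr p e (update x e' true) - ctr p e (update x e' false) = 0 := by
        intro x; rw [ctr_update_of_ne p hee, ctr_update_of_ne p hee]; ring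
      simp only [this, mul_zero, Finset.sum_const_zero, mul_zero]
  have hexp : ∀ x : E → Bool, wt p x * (∑ e, a e * ctr p e x) ^ 2
      = ∑ e, ∑ e', a e * a e' * (wt p x * (ctr p e x * ctr p e' x)) := by
    intro x
    rw [sq, Finset.sum_mul_sum, Finset.mul_sum]
    refine Finset.sum_congr rfl fun e _ => ?_
    rw [Finset.mul_sum]
    exact Finset.sum_congr rfl fun e' _ => by ring
  rw [Finset.sum_congr rfl (fun x _ => hexp x), Finset.sum_comm]
  refine Finset.sum_congr rfl fun e _ => ?_
  rw [Finset.sum_comm]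
  have : ∀ e', ∑ x : E → Bool, a e * a e' * (wt p x * (ctr p e x * ctr p e' x)) = a e * a e' * (if e = e' then p e * (1 - p e) else 0) := by
    intro e'; rw [← Finset.mul_sum, hdiag e e']
  rw [Finset.sum_congr rfl (fun e' _ => this e')]
  simp only [mul_ite, mul_zero, Finset.sum_ite_eq, Finset.mem_univ, if_true]
  ring

include hsymm hends h0 h1 hsep hq0 hq1 hδ0 hδ in
/-- **A CROSSING IS NEARLY UNCORRELATED WITH EVERY WEIGHTED EDGE COUNT** (`k = 1` directly, no Fourier analysis: `Cov(𝟙{X↔B}, 𝟙[ω_e]) =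
p_e(1−p_e)·P(e pivotal)` by Russo/Margulis, Cauchy–Schwarz, and gen 20's `Σ_e p_e(1−p_e)P(e piv)² ≤ δ·P(X↔B)`): for every weight vector `a`,
**`|E[𝟙{X↔B}·Σ_e a_e(𝟙[ω_e] − p_e)]| ≤ √(δ·P(X↔B))·√(Σ_e a_e²·p_e(1−p_e))`** — the right factor is the standard deviation of the count.
In BKS's words: the crossing cannot be predicted from (the linear statistic of) any weighted majority of the edges.
[cite: BenjaminiKalaiSchramm1999, §1.3 Thm 1.7 (noise sensitivity ⇔ uncorrelated with weighted majorities) and Thm 1.3 (Σ I_e²)]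
[cite: SchrammSteif2010, Thm 1.8 (k = 1)] -/
theorem abs_cov_gcross_linear_le (a : E → ℝ) :
    |∑ x : E → Bool, wt p x * (gcross edge X B x * ∑ e, a e * ctr p e x)|
      ≤ Real.sqrt (δ * ∑ x : E → Bool, wt p x * gcross edge X B x) * Real.sqrt (∑ e, a e ^ 2 * (p e * (1 - p e))) := by
  -- the covariance as a sum of weighted pivotal probabilities
  have hcov : ∑ x : E → Bool, wt p x * (gcross edge X B x * ∑ e, a e * ctr p e x)
      = ∑ e, a e * (p e * (1 - p e) * pivCross edge p X B e) := by
    have : ∀ x : E → Bool, wt p x * (gcross edge X B x * ∑ e, a e * ctr p e x)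
        = ∑ e, a e * (wt p x * (gcross edge X B x * ctr p e x)) := by
      intro x; rw [Finset.mul_sum, Finset.mul_sum]; exact Finset.sum_congr rfl fun e _ => by ring
    rw [Finset.sum_congr rfl (fun x _ => this x), Finset.sum_comm]
    refine Finset.sum_congr rfl fun e _ => ?_
    rw [← Finset.mul_sum, sum_wt_gcross_mul_ctr p X B e]
  rw [hcov]
  -- Cauchy–Schwarz with the weights `√(p_e(1−p_e))` split between the two factors
  have hsplit : ∀ e, a e * (p e * (1 - p e) * pivCross edge p X B e)
      = (a e * Real.sqrt (p e * (1 - p e))) * (Real.sqrt (p e * (1 - p e)) * pivCross edge p X B e) := by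
    intro e
    have hpe : 0 ≤ p e * (1 - p e) := mul_nonneg (h0 e) (by linarith [h1 e])
    calc a e * (p e * (1 - p e) * pivCross edge p X B e)
        = a e * ((Real.sqrt (p e * (1 - p e)) * Real.sqrt (p e * (1 - p e))) * pivCross edge p X B e) := by
          rw [Real.mul_self_sqrt hpe]
      _ = _ := by ring
  rw [Finset.sum_congr rfl (fun e _ => hsplit e)]
  have hCS := Finset.sum_mul_sq_le_sq_mul_sq (Finset.univ : Finset E)
    (fun e => a e * Real.sqrt (p e * (1 - p e))) (fun e => Real.sqrt (p e * (1 - p e)) * pivCross edge p X B e)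
  have hA : ∑ e, (a e * Real.sqrt (p e * (1 - p e))) ^ 2 = ∑ e, a e ^ 2 * (p e * (1 - p e)) := by
    refine Finset.sum_congr rfl fun e _ => ?_
    rw [mul_pow, Real.sq_sqrt (mul_nonneg (h0 e) (by linarith [h1 e]))]
  have hB : ∑ e, (Real.sqrt (p e * (1 - p e)) * pivCross edge p X B e) ^ 2 = ∑ e, p e * (1 - p e) * (pivCross edge p X B e) ^ 2 := by
    refine Finset.sum_congr rfl fun e _ => ?_
    rw [mul_pow, Real.sq_sqrt (mul_nonneg (h0 e) (by linarith [h1 e]))]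
  have hpiv := sum_bias_mul_pivCross_sq_le hsymm hends p h0 h1 Z hsep q hq0 hq1 hδ0 hδ
  have hP0 : 0 ≤ ∑ x : E → Bool, wt p x * gcross edge X B x :=
    Finset.sum_nonneg fun x _ => mul_nonneg (wt_nonneg h0 h1 x) (by rcases gcross_mem edge X B x with h | h <;> simp [h])
  have hV0 : 0 ≤ ∑ e, a e ^ 2 * (p e * (1 - p e)) :=
    Finset.sum_nonneg fun e _ => mul_nonneg (sq_nonneg _) (mul_nonneg (h0 e) (by linarith [h1 e]))
  have hsq : (∑ e, (a e * Real.sqrt (p e * (1 - p e))) * (Real.sqrt (p e * (1 - p e)) * pivCross edge p X B e)) ^ 2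
      ≤ (Real.sqrt (δ * ∑ x : E → Bool, wt p x * gcross edge X B x) * Real.sqrt (∑ e, a e ^ 2 * (p e * (1 - p e)))) ^ 2 := by
    rw [mul_pow, Real.sq_sqrt (mul_nonneg hδ0 hP0), Real.sq_sqrt hV0]
    calc _ ≤ (∑ e, (a e * Real.sqrt (p e * (1 - p e))) ^ 2) * ∑ e, (Real.sqrt (p e * (1 - p e)) * pivCross edge p X B e) ^ 2 := hCS
      _ = (∑ e, a e ^ 2 * (p e * (1 - p e))) * ∑ e, p e * (1 - p e) * (pivCross edge p X B e) ^ 2 := by rw [hA, hB]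
      _ ≤ (∑ e, a e ^ 2 * (p e * (1 - p e))) * (δ * ∑ x : E → Bool, wt p x * gcross edge X B x) :=
          mul_le_mul_of_nonneg_left hpiv hV0
      _ = _ := by ring
  exact abs_le_of_sq_le_sq hsq (mul_nonneg (Real.sqrt_nonneg _) (Real.sqrt_nonneg _))

end Crossing

end Summit.CriticalPhenomena.PercolationContinuityZ3.Theorems.Crossing.Spectral

end
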